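import Summits.ValiantsHypothesis.ValiantsHypothesis.Theorems.LacunarySymmetroidMatrixDescartesDoorA26WallBubblingSecondOrder
import Summits.ValiantsHypothesis.ValiantsHypothesis.Theorems.LacunarySymmetroidMatrixDescartesDoorA26WallBubblingSecondOrderClusters

/-!
# `DoorA26` line `wall_bubbling` — second-order engine, part 3: the mixed-wall blow-up datum in `hblock` form

HONEST FRAMING.  Object-search cell `pub-symmetroid`; crux `Theses.LacunarySymmetroid.DoorA26` (stmt-ValiantsHypothesis-19979; OPEN,
typed, never asserted).  Obligation (M) `stub_mixedWalls` of the line `Cruxes/DoorA26/Lines/wall_bubbling.lean` (slot W1 of desk R2664)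
runs a SECOND-ORDER sieve along a sequence of realisable stage matrices whose `(i,k,l)`-block, normalised, converges to the mixed-wall
pattern `P = Eᵢᵢ − ½(Eₖₗ + Eₗₖ)` (hypothesis `hblock` of `…WallBubblingMixedParity`).  This file PRODUCES that datum from an accumulation of
twenties at a generic mixed wall: `mixedWall_hblock` = part 2's `blowup_datum` (cluster data with realisability at every stage + the
blow-up cluster) ∘ part 1's `mixedWall_firstOrder_pattern` (the first-order pattern is forced by `BlockSumsZero` + symmetry), with the
normalisation `B = H c (i,i) ≠ 0`; it also records that every limit entry outside `{(i,i),(k,l),(l,k)}` vanishes (the cross entries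
`G^ν_{j,I}` are `o(1)`, so the second-level `ρ`-normalisation of W1's parity limit is genuinely needed — not in this file).
Nothing here bears on (M)/(W)/(R) themselves, on `DoorA26`, on `MatrixDescartes` (18050) or on `VP ≠ VNP`.

[this work] Packaging only; the mathematics is the chain's (B) and parts 1–2.
-/

-- `Summit.ValiantsHypothesis.ValiantsHypothesis.…` repeats a component by the D-0017 layout
-- (single-conjunct summit), which the `dupNamespace` linter flags; the name is mandated.
set_option linter.dupNamespace false

namespace Summit.ValiantsHypothesis.ValiantsHypothesis.Theorems.LacunarySymmetroidMatrixDescartes.WallBubbling.SecondOrder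

open Finset Filter Topology
open Summit.ValiantsHypothesis.ValiantsHypothesis.Theorems.LacunarySymmetroidMatrixDescartes.WallBubbling.Bubbling

/-! ## Part 3 — the mixed-wall `hblock` datum -/

/-- **Mixed-wall blow-up datum in `hblock` form.**  Let `δ⋆ ∈ closure TwentyLocus` lie on a GENERIC mixed wall: distinct letters
`i, k, l` with `2 δ⋆ᵢ = δ⋆ₖ + δ⋆ₗ` and no other pair-sum coincidence.  Then there are cluster data `D` (every stage matrix realisable),
a blow-up cluster `c` and a scale `B ≠ 0` (namely `B = H c (i,i)`) such that the stage matrices, restricted to the block `I = (i,k,l)`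
and divided by `B`, converge to the mixed-wall pattern `P = Eᵢᵢ − ½(Eₖₗ + Eₗₖ)` — W1's hypothesis `hblock` — while every limit entry
outside `{(i,i),(k,l),(l,k)}` vanishes (so the cross entries `G^ν_{j,I}` are `o(1)`: the second-level normalisation is genuinely needed).
[this work] -/
theorem mixedWall_hblock (δstar : Fin 6 → ℝ) (hclos : δstar ∈ closure TwentyLocus)
    (i k l : Fin 6) (hik : i ≠ k) (hil : i ≠ l) (hkl : k ≠ l) (hwall : 2 * δstar i = δstar k + δstar l)
    (honly : ∀ a b a' b' : Fin 6, δstar a + δstar b = δstar a' + δstar b' →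
      ((a = a' ∧ b = b') ∨ (a = b' ∧ b = a')) ∨
      (((a = i ∧ b = i) ∨ (a = k ∧ b = l) ∨ (a = l ∧ b = k)) ∧
       ((a' = i ∧ b' = i) ∨ (a' = k ∧ b' = l) ∨ (a' = l ∧ b' = k)))) :
    ∃ (D : ClusterLimit δstar) (c : Fin D.C) (B : ℝ), B ≠ 0 ∧
      (∀ c' ν, Realisable (Matrix.of fun x y => D.a c' ν (x, y))) ∧
      (∀ x y : Fin 6, ¬ ((x = i ∧ y = i) ∨ (x = k ∧ y = l) ∨ (x = l ∧ y = k)) → D.H c (x, y) = 0) ∧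
      Tendsto (fun ν => B⁻¹ • (Matrix.of fun x y => D.a c ν (x, y)).submatrix ![i, k, l] ![i, k, l]) atTop
        (𝓝 !![1, 0, 0; 0, 0, -1/2; 0, -1/2, 0]) := by
  have hcoin : ∃ i' j' k' l' : Fin 6, (i', j') ≠ (k', l') ∧ (i', j') ≠ (l', k') ∧
      δstar i' + δstar j' = δstar k' + δstar l' :=
    ⟨i, i, k, l, fun h => hik (Prod.mk.inj h).1, fun h => hil (Prod.mk.inj h).1, by linarith⟩
  obtain ⟨D, c, hreal, hne, hrealH, hBSZ, htend⟩ := blowup_datum δstar hclos hcoin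
  have hsym : (Matrix.of fun x y => D.H c (x, y)).IsSymm := isSymm_of_realisable hrealH
  obtain ⟨hzero, hkl', hlk'⟩ :=
    mixedWall_firstOrder_pattern δstar i k l hik hil hkl hwall honly _ hsym hBSZ
  simp only [Matrix.of_apply] at hzero hkl' hlk'
  set B : ℝ := D.H c (i, i) with hBdef
  have hB : B ≠ 0 := by
    intro hB0
    apply hne
    ext x y
    rw [Matrix.of_apply, Matrix.zero_apply]
    by_cases hs : (x = i ∧ y = i) ∨ (x = k ∧ y = l) ∨ (x = l ∧ y = k)
    · rcases hs with ⟨rfl, rfl⟩ | ⟨rfl, rfl⟩ | ⟨rfl, rfl⟩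
      · exact hB0
      · rw [hkl', hB0]; norm_num
      · rw [hlk', hB0]; norm_num
    · exact hzero x y hs
  refine ⟨D, c, B, hB, hreal, hzero, ?_⟩
  -- entrywise
  have hik' : k ≠ i := fun h => hik h.symm
  have hil' : l ≠ i := fun h => hil h.symm
  have hkl'' : l ≠ k := fun h => hkl h.symm
  have key : ∀ x y : Fin 3, B⁻¹ * D.H c ((![i, k, l] : Fin 3 → Fin 6) x, (![i, k, l] : Fin 3 → Fin 6) y)
      = (!![1, 0, 0; 0, 0, -1/2; 0, -1/2, 0] : Matrix (Fin 3) (Fin 3) ℝ) x y := by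
    intro x y
    fin_cases x <;> fin_cases y <;>
      simp only [Matrix.cons_val_zero, Matrix.cons_val_one, Matrix.cons_val_two, Matrix.head_cons, Matrix.tail_cons,
        Fin.zero_eta, Fin.mk_one, Fin.reduceFinMk, Matrix.of_apply, Matrix.cons_val', Matrix.empty_val',
        Matrix.cons_val_fin_one, Matrix.head_fin_const]
    · rw [← hBdef]; exact inv_mul_cancel₀ hB
    · rw [hzero i k (by rintro (⟨-, h⟩ | ⟨h, -⟩ | ⟨h, -⟩) <;> [exact hik' h; exact hik h; exact hil h]), mul_zero]
    · rw [hzero i l (by rintro (⟨-, h⟩ | ⟨h, -⟩ | ⟨h, -⟩) <;> [exact hil' h; exact hik h; exact hil h]), mul_zero]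
    · rw [hzero k i (by rintro (⟨h, -⟩ | ⟨-, h⟩ | ⟨h, -⟩) <;> [exact hik' h; exact hil' (h ▸ rfl) |>.elim; exact hkl (h ▸ rfl) |>.elim]), mul_zero]
    · rw [hzero k k (by rintro (⟨h, -⟩ | ⟨-, h⟩ | ⟨h, -⟩) <;> [exact hik' h; exact hkl h; exact hkl h]), mul_zero]
    · rw [hkl']; field_simp
    · rw [hzero l i (by rintro (⟨h, -⟩ | ⟨h, -⟩ | ⟨-, h⟩) <;> [exact hil' h; exact hkl'' h; exact hik h]), mul_zero]
    · rw [hlk']; field_simp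
    · rw [hzero l l (by rintro (⟨h, -⟩ | ⟨h, -⟩ | ⟨-, h⟩) <;> [exact hil' h; exact hkl'' h; exact hkl h.symm |>.elim]), mul_zero]
  refine tendsto_pi_nhds.mpr fun x => tendsto_pi_nhds.mpr fun y => ?_
  have h1 := (D.ha c ((![i, k, l] : Fin 3 → Fin 6) x, (![i, k, l] : Fin 3 → Fin 6) y)).const_mul B⁻¹
  rw [key x y] at h1
  simpa only [Matrix.smul_apply, Matrix.submatrix_apply, Matrix.of_apply, smul_eq_mul] using h1

end Summit.ValiantsHypothesis.ValiantsHypothesis.Theorems.LacunarySymmetroidMatrixDescartes.WallBubbling.SecondOrder
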